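import Mathlib
import HarnessLib
import Summits.NavierStokesRegularity.NavierStokesRegularity.Theorems.TaylorModelRungThreeCertificateFormat
import Summits.NavierStokesRegularity.NavierStokesRegularity.Theorems.TaylorModelRungThreeCertificateSoundBridge
import Summits.NavierStokesRegularity.NavierStokesRegularity.Theorems.TaylorModelRungThreeCertificateSoundField

/-!
# Crux K1b-DR (stmt-NavierStokesRegularity-23954), line `taylor-model` — certificate SOUNDNESS, part 7: the exact
# SCALAR FIELD `ℚ(√2)` of CERT-CONTRACT-23954 §1 and the discharge of the coefficient hypothesis `CoefOK`

The clock factor `2^(5(k-μ₃)/2)` of Tao's cascade field is irrational across neighbouring shells, so the certificate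
tables live in `K = ℚ(√2)` (CERT-CONTRACT-23954 v1 §1). This file realises `K` as Mathlib's quadratic algebra
`QuadraticAlgebra ℚ 2 0` (`ω² = 2`; a computable field, since `r² ≠ 2` on `ℚ`), equips it with the DECIDABLE linear
order pulled back from the real embedding `z ↦ z.re + z.im·√2` (decided by sign/size comparisons of rationals, so
that `decide` evaluates the checkers), proves `IsStrictOrderedRing`, packages the embedding as a MONOTONE ring map
`QS2.toRealHom : QS2 →+* ℝ` with `toRealHom ω = √2`, and gives the executable test `CertTables.checkCoef` of the
coefficient table (`coef = α · ω^(5(k-μ₃))` exactly) with its soundness `coefOK_of_checkCoef : checkCoef = true →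
T.CoefOK QS2.toRealHom`. With parts 1–6 every hypothesis of `chain_of_checks` is then a `decide`-able Boolean on
literal tables. MODEL-lattice rung TL-M3; nothing here concerns the Navier–Stokes equations.
-/

-- the sub-problem namespace repeats the summit name by design (D-0017)
set_option linter.dupNamespace false

namespace Summit.NavierStokesRegularity.NavierStokesRegularity.Theorems.TaylorModelCert

open scoped BigOperators
open Literature.Analysis.FluidPDE.TaoCascade Literature.Analysis.FluidPDE.TaoCascade.TaylorChain

/-- The scalar field `ℚ(√2)` of the certificate: Mathlib's quadratic algebra with `ω² = 2 + 0·ω`. [folklore] -/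
abbrev QS2 : Type := QuadraticAlgebra ℚ 2 0

namespace QS2

/-- `X² = 2` has no rational root (irrationality of `√2`), so `QS2` is a field. [folklore] -/
instance instFactIrrational : Fact (∀ r : ℚ, r ^ 2 ≠ (2 : ℚ) + 0 * r) := ⟨fun r h => by
  have h2 : ((r : ℝ)) ^ 2 = 2 := by rw [zero_mul, add_zero] at h; exact_mod_cast h
  have : Real.sqrt 2 = ((|r| : ℚ) : ℝ) := by
    rw [Rat.cast_abs, ← h2, Real.sqrt_sq_eq_abs]
  exact irrational_sqrt_two.ne_rat _ this⟩

/-- The real embedding `z ↦ z.re + z.im·√2` as a function. [folklore] -/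
noncomputable def toR (z : QS2) : ℝ := (z.re : ℝ) + (z.im : ℝ) * Real.sqrt 2

/-- `toR` is additive. [folklore] -/
theorem toR_add (z w : QS2) : toR (z + w) = toR z + toR w := by
  simp only [toR, QuadraticAlgebra.re_add, QuadraticAlgebra.im_add, Rat.cast_add]; ring

/-- `toR` is multiplicative. [folklore] -/
theorem toR_mul (z w : QS2) : toR (z * w) = toR z * toR w := by
  have hs : Real.sqrt 2 ^ 2 = 2 := Real.sq_sqrt (by norm_num)
  simp only [toR, QuadraticAlgebra.re_mul, QuadraticAlgebra.im_mul, Rat.cast_add, Rat.cast_mul, Rat.cast_ofNat,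
    Rat.cast_zero]
  linear_combination (-((z.im : ℝ) * w.im)) * hs

/-- `toR 0 = 0`. [folklore] -/
theorem toR_zero : toR 0 = 0 := by simp [toR]

/-- `toR 1 = 1`. [folklore] -/
theorem toR_one : toR 1 = 1 := by
  simp [toR, QuadraticAlgebra.re_one, QuadraticAlgebra.im_one]

/-- `toR` is injective (irrationality of `√2`). [folklore] -/
theorem toR_injective : Function.Injective toR := by
  intro z w h
  simp only [toR] at h
  have him : z.im = w.im := by
    by_contra hne
    have hne' : ((w.im : ℝ) - z.im) ≠ 0 := by
      have : (w.im : ℝ) ≠ z.im := by exact_mod_cast (Ne.symm hne)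
      exact sub_ne_zero.2 this
    have : Real.sqrt 2 = (((z.re - w.re) / (w.im - z.im) : ℚ) : ℝ) := by
      push_cast
      field_simp
      linarith
    exact irrational_sqrt_two.ne_rat _ this
  have hre : (z.re : ℝ) = w.re := by
    have := h; rw [him] at this; linarith
  exact QuadraticAlgebra.ext (by exact_mod_cast hre) him

/-- **The real embedding `ℚ(√2) →+* ℝ`.** [folklore] -/
noncomputable def toRealHom : QS2 →+* ℝ where
  toFun := toR
  map_one' := toR_one
  map_mul' := toR_mul
  map_zero' := toR_zero
  map_add' := toR_add

/-- Unfolding `toRealHom`. [folklore] -/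
theorem toRealHom_apply (z : QS2) : toRealHom z = (z.re : ℝ) + (z.im : ℝ) * Real.sqrt 2 := rfl

/-- `toRealHom ω = √2`. [folklore] -/
theorem toRealHom_omega : toRealHom (⟨0, 1⟩ : QS2) = Real.sqrt 2 := by
  simp [toRealHom_apply]

/-- `toRealHom` on rationals. [folklore] -/
theorem toRealHom_C (q : ℚ) : toRealHom (⟨q, 0⟩ : QS2) = q := by
  simp [toRealHom_apply]

/-! ### The decidable order -/

/-- Non-negativity of `a + b√2`, decided on the rationals `a, b` by sign and size comparison. [folklore] -/
def Nonneg (z : QS2) : Prop :=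
  (0 ≤ z.re ∧ 0 ≤ z.im) ∨ (0 ≤ z.re ∧ z.im < 0 ∧ 2 * z.im ^ 2 ≤ z.re ^ 2) ∨
    (z.re < 0 ∧ 0 < z.im ∧ z.re ^ 2 ≤ 2 * z.im ^ 2)

/-- `Nonneg` is decidable by rational arithmetic. [folklore] -/
instance decNonneg : DecidablePred Nonneg := fun z =>
  inferInstanceAs (Decidable ((0 ≤ z.re ∧ 0 ≤ z.im) ∨ (0 ≤ z.re ∧ z.im < 0 ∧ 2 * z.im ^ 2 ≤ z.re ^ 2) ∨
    (z.re < 0 ∧ 0 < z.im ∧ z.re ^ 2 ≤ 2 * z.im ^ 2)))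

/-- `Nonneg z ↔ 0 ≤ toR z`. [folklore] -/
theorem nonneg_iff (z : QS2) : Nonneg z ↔ 0 ≤ toR z := by
  have hs0 : 0 < Real.sqrt 2 := Real.sqrt_pos.2 (by norm_num)
  have hs : Real.sqrt 2 * Real.sqrt 2 = 2 := Real.mul_self_sqrt (by norm_num)
  unfold Nonneg toR
  set a : ℝ := (z.re : ℝ) with ha
  set b : ℝ := (z.im : ℝ) with hb
  have e1 : (0 ≤ z.re) ↔ 0 ≤ a := by rw [ha]; exact_mod_cast Iff.rfl
  have e2 : (0 ≤ z.im) ↔ 0 ≤ b := by rw [hb]; exact_mod_cast Iff.rfl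
  have e3 : (z.im < 0) ↔ b < 0 := by rw [hb]; exact_mod_cast Iff.rfl
  have e4 : (z.re < 0) ↔ a < 0 := by rw [ha]; exact_mod_cast Iff.rfl
  have e5 : (0 < z.im) ↔ 0 < b := by rw [hb]; exact_mod_cast Iff.rfl
  have e6 : (2 * z.im ^ 2 ≤ z.re ^ 2) ↔ 2 * b ^ 2 ≤ a ^ 2 := by rw [ha, hb]; exact_mod_cast Iff.rfl
  have e7 : (z.re ^ 2 ≤ 2 * z.im ^ 2) ↔ a ^ 2 ≤ 2 * b ^ 2 := by rw [ha, hb]; exact_mod_cast Iff.rfl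
  rw [e1, e2, e3, e4, e5, e6, e7]
  constructor
  · rintro (⟨h1, h2⟩ | ⟨h1, h2, h3⟩ | ⟨h1, h2, h3⟩)
    · positivity
    · by_contra hneg
      rw [not_le] at hneg
      have hpos : 0 < a - b * Real.sqrt 2 := by nlinarith
      nlinarith [mul_neg_of_neg_of_pos (show a + b * Real.sqrt 2 < 0 from hneg) hpos]
    · by_contra hneg
      rw [not_le] at hneg
      have hpos : 0 < b * Real.sqrt 2 - a := by nlinarith
      nlinarith [mul_neg_of_neg_of_pos (show a + b * Real.sqrt 2 < 0 from hneg) hpos]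
  · intro h
    by_cases hb0 : 0 ≤ b
    · by_cases ha0 : 0 ≤ a
      · exact Or.inl ⟨ha0, hb0⟩
      · rw [not_le] at ha0
        have hb1 : 0 < b := by
          rcases hb0.lt_or_eq with hb1 | hb1
          · exact hb1
          · exfalso; rw [← hb1] at h; linarith
        refine Or.inr (Or.inr ⟨ha0, hb1, ?_⟩)
        nlinarith [mul_nonneg h (show 0 ≤ b * Real.sqrt 2 - a by nlinarith)]
    · rw [not_le] at hb0
      have ha0 : 0 ≤ a := by nlinarith
      refine Or.inr (Or.inl ⟨ha0, hb0, ?_⟩)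
      nlinarith [mul_nonneg h (show 0 ≤ a - b * Real.sqrt 2 by nlinarith)]

/-- `z ≤ w` iff `w - z` is non-negative. [folklore] -/
instance instLE : LE QS2 := ⟨fun z w => Nonneg (w - z)⟩
/-- `z < w` iff `z ≤ w ∧ ¬ w ≤ z`. [folklore] -/
instance instLT : LT QS2 := ⟨fun z w => Nonneg (w - z) ∧ ¬ Nonneg (z - w)⟩

/-- `≤` is decidable. [folklore] -/
instance decLE : DecidableLE QS2 := fun z w => inferInstanceAs (Decidable (Nonneg (w - z)))
/-- `<` is decidable. [folklore] -/
instance decLT : DecidableLT QS2 := fun z w => inferInstanceAs (Decidable (Nonneg (w - z) ∧ ¬ Nonneg (z - w)))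

/-- The order is the pull-back of the real order. [folklore] -/
theorem le_iff_toR (z w : QS2) : z ≤ w ↔ toR z ≤ toR w := by
  show Nonneg (w - z) ↔ _
  rw [nonneg_iff, show w - z = w + -z from sub_eq_add_neg w z, toR_add]
  have : toR (-z) = -toR z := by
    have h0 := toR_add z (-z)
    rw [add_neg_cancel, toR_zero] at h0
    linarith
  rw [this]; constructor <;> intro h <;> linarith

/-- **`ℚ(√2)` is linearly ordered** (decidably). [folklore] -/
instance instLinearOrder : LinearOrder QS2 where
  le_refl z := (le_iff_toR z z).2 le_rfl
  le_trans a b c h1 h2 := (le_iff_toR _ _).2 (((le_iff_toR _ _).1 h1).trans ((le_iff_toR _ _).1 h2))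
  lt_iff_le_not_ge _ _ := Iff.rfl
  le_antisymm a b h1 h2 := toR_injective (le_antisymm ((le_iff_toR _ _).1 h1) ((le_iff_toR _ _).1 h2))
  le_total a b := by
    rcases le_total (toR a) (toR b) with h | h
    · exact Or.inl ((le_iff_toR _ _).2 h)
    · exact Or.inr ((le_iff_toR _ _).2 h)
  toDecidableLE := decLE
  toDecidableLT := decLT
  toDecidableEq := inferInstance

/-- Strict order is the pull-back of the real strict order. [folklore] -/
theorem lt_iff_toR (z w : QS2) : z < w ↔ toR z < toR w := by
  rw [lt_iff_le_not_ge, le_iff_toR, le_iff_toR, lt_iff_le_not_ge]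

/-- **`ℚ(√2)` is a strictly ordered ring** (pulled back along the real embedding). [folklore] -/
instance instIsStrictOrderedRing : IsStrictOrderedRing QS2 :=
  Function.Injective.isStrictOrderedRing toR toR_zero toR_one toR_add toR_mul (le_iff_toR _ _).symm
    (lt_iff_toR _ _).symm

/-- **The real embedding is monotone.** [folklore] -/
theorem toRealHom_monotone : Monotone toRealHom := fun _ _ h => (le_iff_toR _ _).1 h

/-- The kernel evaluates the order: `1 + √2 ≤ 3`. [folklore] -/
example : ((⟨1, 1⟩ : QS2) ≤ ⟨3, 0⟩) := by decide +kernel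

/-- The kernel evaluates the field operations: `(1 + √2)⁻¹ = √2 - 1`, `ω⁻² = 1/2`. [folklore] -/
example : ((⟨1, 1⟩ : QS2)⁻¹) = ⟨-1, 1⟩ ∧ ((⟨0, 1⟩ : QS2) ^ (-2 : ℤ)) = ⟨1 / 2, 0⟩ := by decide +kernel

end QS2

/-! ### The coefficient table check over `ℚ(√2)` -/

namespace CertTables

/-- COEFFICIENT CHECK (CERT-CONTRACT-23954 §2): on the window, `coef = α · ω^(5(k-μ₃))` EXACTLY in `ℚ(√2)`, for every
`(a, b, i, μ)` and window shell `k`. [folklore] -/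
def checkCoef (T : CertTables QS2) : Bool :=
  allN T.m fun kk => allN 4 fun a => allN 4 fun b => allN 4 fun i => allN 4 fun μi =>
    decide (T.coefAt ⟨a % 4, Nat.mod_lt _ (by omega)⟩ ⟨b % 4, Nat.mod_lt _ (by omega)⟩ ⟨i % 4, Nat.mod_lt _ (by omega)⟩
        μi ((kk : ℤ) - T.Kb) =
      vget T.α (((a % 4 * 4 + b % 4) * 4 + i % 4) * 4 + μi) *
        (⟨0, 1⟩ : QS2) ^ (5 * (((kk : ℤ) - T.Kb) - (shifts.getD μi (0, 0, 0)).2.2)))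

/-- `√2 ^ z = 2 ^ (z/2)` for integers `z`. [folklore] -/
theorem sqrt_two_zpow (z : ℤ) : Real.sqrt 2 ^ z = (2 : ℝ) ^ ((z : ℝ) / 2) := by
  rw [Real.sqrt_eq_rpow, ← Real.rpow_intCast, ← Real.rpow_mul (by norm_num)]
  congr 1; ring

/-- **Soundness of the coefficient check**: `checkCoef = true` discharges the hypothesis `CoefOK` of the soundness
theorems for the real embedding of `ℚ(√2)`. [folklore] -/
theorem coefOK_of_checkCoef (T : CertTables QS2) (h : T.checkCoef = true) : T.CoefOK QS2.toRealHom := by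
  intro a b i μi k hμ hk1 hk2
  have hk : -T.Kb ≤ k ∧ k ≤ T.Ka := ⟨hk1, hk2⟩
  have hkk := T.toNat_shell_lt_m hk
  have h1 := (allN_eq_true.1 ((allN_eq_true.1 ((allN_eq_true.1 ((allN_eq_true.1 ((allN_eq_true.1 h) _ hkk)) a.val
    a.isLt)) b.val b.isLt)) i.val i.isLt)) μi hμ
  have ek : (((k + T.Kb).toNat : ℕ) : ℤ) - T.Kb = k := by omega
  have ea : (⟨a.val % 4, Nat.mod_lt _ (by omega)⟩ : Fin 4) = a := Fin.ext (Nat.mod_eq_of_lt a.isLt)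
  have eb : (⟨b.val % 4, Nat.mod_lt _ (by omega)⟩ : Fin 4) = b := Fin.ext (Nat.mod_eq_of_lt b.isLt)
  have ei : (⟨i.val % 4, Nat.mod_lt _ (by omega)⟩ : Fin 4) = i := Fin.ext (Nat.mod_eq_of_lt i.isLt)
  have h2 := of_decide_eq_true h1
  rw [ek, ea, eb, ei, Nat.mod_eq_of_lt a.isLt, Nat.mod_eq_of_lt b.isLt, Nat.mod_eq_of_lt i.isLt] at h2
  rw [h2, map_mul, map_zpow₀, QS2.toRealHom_omega, sqrt_two_zpow]
  congr 1
  push_cast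
  ring_nf

end CertTables

end Summit.NavierStokesRegularity.NavierStokesRegularity.Theorems.TaylorModelCert
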